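/-
Copyright (c) 2026 the pub-hodgecm-mathlib formalisation cell (harness21).  Prover seat hodgecm-mathlib-K2Liu-p10 (g7) (S8 hand), Track B ∕ K2-LIT,
h413 = `stmt-HodgeConjecture-24833`, R90-TF section S8 «ContSpec-n½», the (M) «middle residue» road, (w6) «THE DICTIONARY ITSELF» (S8 dealer R90-CS-plan (g4)
S8-R291; census `K2/K2Liu-p10/g7/CENSUS-w6-GlobalDictionaryData.K2Liu-p10-g7.md` 354210d4787f6e64), part (w6-a): the KER-FACTORING `Res = J ∘ A(3∕2)` and the
REDUCTION of ★ `dictionary_D2_of_localIntertwiner`'s tensor binder `hfac` to the ONE printed local-global letter TENSOR-N.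
THEOREMS ONLY (no `def`, no instance, no notation, no `sorry`).
-/
import Summits.HodgeConjecture.HodgeConjecture.Theorems.R90S8ResMidSectionDictionaryIntertwinerU3   -- ★ p865340 (this seat): `dictionary_D2_of_localIntertwiner` (+ ★ p865214, ★ p864867, ★ Literature `KeysOrientation`)
import Mathlib.LinearAlgebra.Basis.VectorSpace                                                      -- `LinearMap.exists_extend`
import HarnessLib

/-!
# S8 (M) road, (w6-a): `Res = J ∘ A(3∕2)` from «`A(3∕2)φ = 0 ⇒ Res φ = 0`» (KER ★ p864667 ∘ scalar-out ★ p864847), and the (D2) package with its tensor binder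
# REDUCED to TENSOR-N «`A(3∕2)(xv ⊗ φ^v) = TwA (N_v(3∕2) xv) (A^{(v)}(3∕2) φ^v)`» [MoeglinWaldspurger1995 II.1.6, IV.1.9–IV.1.11; Langlands1976 §6–§7]

Track B ∕ K2-LIT, crux h413 = `stmt-HodgeConjecture-24833`, route of record `HCCMUnconditional`; cell `hodgecm-mathlib`, R90-TF programme, section S8
«ContSpec-n½», the (M) «middle residue» road of socket B ED. 7 :299, RES-INT line 7; consumers ★ p865166 `oneN_at_of_dictionary` ∕ ★ W11
`oneN_at_of_L2dictionary` (K2E5-p17 (g10)) through ★ p865340 `dictionary_D2_of_localIntertwiner`.  Lane `--supports stmt-HodgeConjecture-24833 --as helper`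
(count-neutral).  CLOSES NO SOCKET.

THE STEP (census (w6), lines 4–5).  ★ `dictionary_D2_of_localIntertwiner` reads the (D2) binders `(K, hK, Φ, hker)` from abstract global data
`(ρ σ Tw R Rt hR) (T hT hfac)` in ★ p864867's currency, the tensor clause being `hfac : R (T xv φt) = Tw (N_v xv) (Rt φt)` AT THE LEVEL OF THE `L²` RESIDUE `R = Res`.
In print the factorisation lives one floor below, at the level of the CONSTANT-TERM OPERATOR: `Res` kills `ker M₋₁` (KER ★ p864667, line 4 «`M₋₁φ = 0 ⇒ Res φ = 0`»:
a residual form with vanishing constant term is cuspidal AND residual, hence `0`), `M₋₁ = ρ • A(3∕2)` with `A` the normalised global operator (★ p864847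
`exists_operator_factorisation_threeHalves`), so `ker A(3∕2) ≤ ker Res` and — pure linear algebra over a field — `Res = J ∘ A(3∕2)` for a linear `J` (§1); and the Euler
tensor clause TENSOR-N «`A(3∕2)(ins_v(xv, φ^v)) = TwA (N_v(3∕2) xv) (A^{(v)}(3∕2) φ^v)`» ([MoeglinWaldspurger1995] II.1.6: for `Re z ≫ 0` the unfolded `N(𝔸)`-integral of a
`v`-pure section is the product of the `N(L⁺_v)`-integral and the tail integral; IV.1.9 (b)(d): both sides continue meromorphically, identity theorem down to `z = 3∕2`) then GIVES
`hfac` with `Tw := J ∘ TwA` (§2).  §3 is the COMPOSITE at the CM data: ★ `dictionary_D2_of_localIntertwiner` with `hfac` replaced by {`hker : ker A ≤ ker R` (S-organ, KER ∘ p864847 by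
name once `Res` and `A(3∕2)` are bundled on the block `V`), TENSOR-N `hA`} — so that the (D2) column reads letter-free except {hORIENT, `hσ`, `hf0` (FACT-N local), the SEC-DICT data
`(V, ρ, T, hT)` (census line 3, new currency), `(R, hR)` (census line 4, S–M glue), `hker`, TENSOR-N}.
* §1 (generic; ring level through `range A`, field level total): **`exists_factor_range_of_ker_le`** (`ker A ≤ ker R ⇒ ∃ J : range A →ₗ X, R φ = J ⟨A φ, _⟩`),
  **`factor_range_injective_of_ker_le`** (`ker R ≤ ker A ⇒` that `J` is injective), **`exists_factor_of_ker_le`** (field: `∃ J : U →ₗ X, ∀ φ, R φ = J (A φ)`).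
* §2 (generic, ★ p864867 currency + the operator floor `(A, U, TwA, RtA)`): **`residue_dict_fac_of_factor_of_tensorClause`** (`R (T xv φt) = (TwA.compr₂ J) (Nv xv) (RtA φt)`),
  **`exists_targetDict_of_ker_le_of_tensorClause`** (field: `ker A ≤ ker R` + TENSOR-N ⇒ `∃ Tw, hfac`).
* §3 (CM, ★ p865214 ∕ ★ p865340 variable block): **`dictionary_D2_of_tensorClause`** — `f.ker.quotientRep.IsIrreducible ∧ ∃ Φ, (∀ φt xv, Φ φt xv = R (T xv φt)) ∧ ∀ φt, f.ker ≤ (Φ φt).ker`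
  from `(ρ σ R hR) (A hker) (TwA RtA)` and, under ★ `locallyCompactSpace_cmBorelU`, `∀ T, hT → hA → …`.
HONEST LABEL: §3 is CONDITIONAL on `KeysOrientation` (UNPROVED Literature def); this file pays NO analytic letter (FACT-N local, TENSOR-N, SEC-DICT, `hR`'s exports stay named);
HC_CM is proved only modulo the 7 printed citations (2 remaining named inputs: hLiu418 = `stmt-HodgeConjecture-24832`, h413 = `stmt-HodgeConjecture-24833`) until rung 0 closes;
(M) :299 stays `sorry`; REL ≠ ★ ≠ BUILT; count-neutral.

## References
* [MoeglinWaldspurger1995] C. Mœglin, J.-L. Waldspurger, *Spectral Decomposition and Eisenstein Series* (1995), II.1.6–II.1.7, IV.1.9–IV.1.11.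
* [Langlands1976] R. P. Langlands, *On the Functional Equations Satisfied by Eisenstein Series*, LNM 544 (1976), §6–§7.
* [Rogawski1990] J. D. Rogawski, Ann. of Math. Stud. 123 (1990), §12.2 (2) pp. 173–174, §13.1 p. 199.
* [Lang2002] S. Lang, *Algebra*, 3rd ed. (2002), III §1 (factorisation through the quotient by a kernel), III §5 (complements in vector spaces).
-/

set_option autoImplicit false
set_option linter.dupNamespace false  -- the mandated namespace `…HodgeConjecture.HodgeConjecture.R90.S8` repeats the summit's segment

noncomputable section

open NumberField IsDedekindDomain MeasureTheory
open Literature.NumberTheory Literature.NumberTheory.Automorphic Literature.NumberTheory.Rogawski1990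

namespace Summit.HodgeConjecture.HodgeConjecture.R90.S8

/-! ## §1 KER-factoring: `ker A ≤ ker R ⇒ R = J ∘ A` -/

section KerFactoringRing

variable {𝕜 : Type*} [CommRing 𝕜] {V U X : Type*} [AddCommGroup V] [Module 𝕜 V] [AddCommGroup U] [Module 𝕜 U] [AddCommGroup X] [Module 𝕜 X]

/-- **`ker A ≤ ker R ⇒ R = J ∘ A` ON THE RANGE OF `A`** (any commutative ring): `J := (R lifted to V ⧸ ker A) ∘ (V ⧸ ker A ≃ range A)⁻¹`.  For the (M) road: `A = A(3∕2)` the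
normalised global operator on the block `V`, `R = Res`, the hypothesis = KER ★ p864667 (line 4) ∘ ★ p864847 (`M₋₁ = ρ • A(3∕2)`). [cite: Lang2002, III §1]
[cite: MoeglinWaldspurger1995, IV.1.9–IV.1.11] -/
theorem exists_factor_range_of_ker_le (A : V →ₗ[𝕜] U) (R : V →ₗ[𝕜] X) (hker : LinearMap.ker A ≤ LinearMap.ker R) :
    ∃ J : ↥(LinearMap.range A) →ₗ[𝕜] X, ∀ φ : V, R φ = J ⟨A φ, LinearMap.mem_range_self A φ⟩ := by
  refine ⟨((LinearMap.ker A).liftQ R hker) ∘ₗ (A.quotKerEquivRange.symm : ↥(LinearMap.range A) →ₗ[𝕜] V ⧸ LinearMap.ker A), fun φ => ?_⟩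
  rw [LinearMap.comp_apply, LinearEquiv.coe_coe, LinearMap.quotKerEquivRange_symm_apply_image A φ (LinearMap.mem_range_self A φ), Submodule.mkQ_apply,
    Submodule.liftQ_apply]

/-- **… AND `J` IS INJECTIVE ON `range A` WHEN `ker R ≤ ker A` TOO** (so `ker R = ker A` makes `range A ≅ range R` along `J` — KER ★ p864667 both directions: the residue
classes are a faithful copy of `A(3∕2)(V)`). [cite: Lang2002, III §1] [cite: MoeglinWaldspurger1995, IV.1.11] -/
theorem factor_range_injective_of_ker_le (A : V →ₗ[𝕜] U) (R : V →ₗ[𝕜] X) (J : ↥(LinearMap.range A) →ₗ[𝕜] X)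
    (hJ : ∀ φ : V, R φ = J ⟨A φ, LinearMap.mem_range_self A φ⟩) (hker : LinearMap.ker R ≤ LinearMap.ker A) : Function.Injective J := by
  rw [injective_iff_map_eq_zero]
  rintro ⟨u, φ, rfl⟩ hu
  have hR : R φ = 0 := by rw [hJ φ]; exact hu
  have hA : A φ = 0 := hker (LinearMap.mem_ker.2 hR)
  exact Subtype.ext hA

end KerFactoringRing

section KerFactoringField

variable {𝕜 : Type*} [Field 𝕜] {V U X : Type*} [AddCommGroup V] [Module 𝕜 V] [AddCommGroup U] [Module 𝕜 U] [AddCommGroup X] [Module 𝕜 X]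

/-- **`ker A ≤ ker R ⇒ R = J ∘ A` WITH `J` DEFINED ON ALL OF `U`** (over a field a linear map on `range A` extends to `U`, Mathlib `LinearMap.exists_extend`).
[cite: Lang2002, III §1, III §5] [cite: MoeglinWaldspurger1995, IV.1.9–IV.1.11] -/
theorem exists_factor_of_ker_le (A : V →ₗ[𝕜] U) (R : V →ₗ[𝕜] X) (hker : LinearMap.ker A ≤ LinearMap.ker R) :
    ∃ J : U →ₗ[𝕜] X, ∀ φ : V, R φ = J (A φ) := by
  obtain ⟨J₀, hJ₀⟩ := exists_factor_range_of_ker_le A R hker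
  obtain ⟨J, hJ⟩ := LinearMap.exists_extend J₀
  refine ⟨J, fun φ => ?_⟩
  rw [hJ₀ φ, ← hJ]
  rfl

end KerFactoringField

/-! ## §2 The tensor binder `hfac` of ★ p864867 ∕ ★ p865340 from `R = J ∘ A` and TENSOR-N (generic) -/

section TensorClause

variable {𝕜 : Type*} [CommRing 𝕜] {Vv Wv Vt Ut V U X : Type*} [AddCommGroup Vv] [Module 𝕜 Vv] [AddCommGroup Wv] [Module 𝕜 Wv] [AddCommGroup Vt] [Module 𝕜 Vt]
  [AddCommGroup Ut] [Module 𝕜 Ut] [AddCommGroup V] [Module 𝕜 V] [AddCommGroup U] [Module 𝕜 U] [AddCommGroup X] [Module 𝕜 X]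

/-- **`hfac` ONE FLOOR DOWN.**  If the residue factors through the operator, `R = J ∘ A` (§1), and the operator satisfies the Euler tensor clause TENSOR-N
`A (T xv φt) = TwA (Nv xv) (RtA φt)`, then `R (T xv φt) = Tw (Nv xv) (RtA φt)` with the target dictionary `Tw := TwA.compr₂ J` (`Tw w y = J (TwA w y)`) — the `hfac` binder of
★ `exists_dictIntertwiner` ∕ ★ `dictionary_D2_of_localIntertwiner`. [cite: MoeglinWaldspurger1995, II.1.6, IV.1.9–IV.1.11] [cite: Langlands1976, §6–§7] -/
theorem residue_dict_fac_of_factor_of_tensorClause (T : Vv →ₗ[𝕜] Vt →ₗ[𝕜] V) (R : V →ₗ[𝕜] X) (A : V →ₗ[𝕜] U) (J : U →ₗ[𝕜] X)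
    (Nv : Vv →ₗ[𝕜] Wv) (TwA : Wv →ₗ[𝕜] Ut →ₗ[𝕜] U) (RtA : Vt →ₗ[𝕜] Ut)
    (hRJ : ∀ φ : V, R φ = J (A φ)) (hA : ∀ (xv : Vv) (φt : Vt), A (T xv φt) = TwA (Nv xv) (RtA φt)) (xv : Vv) (φt : Vt) :
    R (T xv φt) = (TwA.compr₂ J) (Nv xv) (RtA φt) := by
  rw [LinearMap.compr₂_apply, hRJ, hA]

end TensorClause

section TensorClauseField

variable {𝕜 : Type*} [Field 𝕜] {Vv Wv Vt Ut V U X : Type*} [AddCommGroup Vv] [Module 𝕜 Vv] [AddCommGroup Wv] [Module 𝕜 Wv] [AddCommGroup Vt] [Module 𝕜 Vt]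
  [AddCommGroup Ut] [Module 𝕜 Ut] [AddCommGroup V] [Module 𝕜 V] [AddCommGroup U] [Module 𝕜 U] [AddCommGroup X] [Module 𝕜 X]

/-- **THE TARGET DICTIONARY `Tw` FROM «`A φ = 0 ⇒ R φ = 0`» AND TENSOR-N** (field): `ker A ≤ ker R` and `A (T xv φt) = TwA (Nv xv) (RtA φt)` give
`∃ Tw, ∀ xv φt, R (T xv φt) = Tw (Nv xv) (RtA φt)`. [cite: MoeglinWaldspurger1995, II.1.6, IV.1.9–IV.1.11] [cite: Langlands1976, §6–§7] -/
theorem exists_targetDict_of_ker_le_of_tensorClause (T : Vv →ₗ[𝕜] Vt →ₗ[𝕜] V) (R : V →ₗ[𝕜] X) (A : V →ₗ[𝕜] U)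
    (Nv : Vv →ₗ[𝕜] Wv) (TwA : Wv →ₗ[𝕜] Ut →ₗ[𝕜] U) (RtA : Vt →ₗ[𝕜] Ut)
    (hker : LinearMap.ker A ≤ LinearMap.ker R) (hA : ∀ (xv : Vv) (φt : Vt), A (T xv φt) = TwA (Nv xv) (RtA φt)) :
    ∃ Tw : Wv →ₗ[𝕜] Ut →ₗ[𝕜] X, ∀ (xv : Vv) (φt : Vt), R (T xv φt) = Tw (Nv xv) (RtA φt) := by
  obtain ⟨J, hJ⟩ := exists_factor_of_ker_le A R hker
  exact ⟨TwA.compr₂ J, residue_dict_fac_of_factor_of_tensorClause T R A J Nv TwA RtA hJ hA⟩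

end TensorClauseField

/-! ## §3 The (D2) package at the CM data with `hfac` REDUCED to {`ker A ≤ ker Res`, TENSOR-N} -/

section Consumer

set_option synthInstance.maxHeartbeats 400000
set_option maxHeartbeats 16000000 -- section-local («measured», ★ p865001 ∕ ★ p865214 ∕ ★ p865340): the CM carrier `Gqs L v` vs the matrix carrier of ★ `cmPrincipalSeries`

variable {L : Type} [Field L] [NumberField L] [IsCMField L]
  (h : KeysOrientation L) {v : HeightOneSpectrum (𝓞 ↥(maximalRealSubfield L))}
  (hns : ∀ w : UnitaryGroup.PlacesOver L v, IsCMField.complexConj L • w.1 = w.1)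
  {μ : (UnitaryGroup.LocalRing L v)ˣ →* ℂˣ}
  {η₁ η₂ : ↥(UnitaryGroup.normOneUnits (UnitaryGroup.conjLocal L (IsCMField.complexConj L) v)) →* ℂˣ}
  (hμ : UnitaryGroup.IsQuadraticCharExtension (UnitaryGroup.conjLocal L (IsCMField.complexConj L) v) μ)
  (hμc : Continuous (fun x => ((μ x : ℂˣ) : ℂ))) (h1c : Continuous (fun x => ((η₁ x : ℂˣ) : ℂ)))
  (h2c : Continuous (fun x => ((η₂ x : ℂˣ) : ℂ)))
  [MeasurableSpace (Gqs L v ⧸ Subgroup.center (Gqs L v))] [BorelSpace (Gqs L v ⧸ Subgroup.center (Gqs L v))]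
  (μZ : Measure (Gqs L v ⧸ Subgroup.center (Gqs L v))) [μZ.IsHaarMeasure]
  {πs πn : IrrClass (Gqs L v)} (hK : KeysCaseTwoLabels L v μ η₁ η₂ πs πn)
  (hs : πs.IsSquareIntegrable μZ) (hn : ¬ πn.IsSquareIntegrable μZ)
  -- the local factor `f = N_v(3∕2)` (FACT-N (c-i), a letter) into a target `τ` without `π²(ξ_v)`-subrepresentations (`hσ`), non-zero (`hf0`)
  {Wτ : Type*} [AddCommGroup Wτ] [Module ℂ Wτ]
  {τ : Representation ℂ ↥(unitaryGroupOfForm (UnitaryGroup.conjLocal L (IsCMField.complexConj L) v) (UnitaryGroup.cmLocalForm L 3 v)) Wτ}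
  (f : (UnitaryGroup.cmPrincipalSeries L 3 v (UnitaryGroup.cmXiTorusChar L v μ η₁ η₂)).IntertwiningMap τ)
  (hσ : ∀ (r : SmoothIrrep (Gqs L v)) (N' : Subrepresentation τ), Nonempty (r.ρ.Equiv N'.toRepresentation) → IrrClass.mk r ≠ πs)
  (hf0 : f.toLinearMap ≠ 0)

include h hns hμ hμc h1c h2c hK hs hn hσ hf0

/-- **THE (D2) PACKAGE AT `K := ker N_v(3∕2)` FROM {`ker A(3∕2) ≤ ker Res`, TENSOR-N}.**  Global data: the block `(V, ρ)` (SEC-DICT), the residue target `(X, σ)` with the residue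
`R : V → X` (`G_v`-equivariant, `hR`), the normalised global operator `A = A(3∕2) : V → U` with `hker : ker A ≤ ker R` (KER ★ p864667 line 4 ∘ ★ p864847 `M₋₁ = ρ • A(3∕2)`),
the operator-floor target dictionary `TwA` and tail operator `RtA = A^{(v)}(3∕2)`; then — under ★ `locallyCompactSpace_cmBorelU` — for every section dictionary `T` that is
`G_v`-equivariant in the local slot (`hT`) and satisfies TENSOR-N `hA : A (T xv φt) = TwA (N_v xv) (RtA φt)`: `I_v(χ_ξ) ⧸ f.ker` is irreducible and `Θ_{φ^v} = R ∘ T(·, φ^v)` are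
intertwining maps `I_v(χ_ξ) → σ` killing `f.ker` (★ `dictionary_D2_of_localIntertwiner` with `Tw := TwA.compr₂ J`, `J` from §1).
[cite: MoeglinWaldspurger1995, II.1.6–II.1.7, IV.1.9–IV.1.11] [cite: Langlands1976, §6–§7] [cite: Rogawski1990, §12.2 (2) pp. 173–174; §13.1 p. 199] -/
theorem dictionary_D2_of_tensorClause {Vt Ut V U X : Type*} [AddCommGroup Vt] [Module ℂ Vt] [AddCommGroup Ut] [Module ℂ Ut]
    [AddCommGroup V] [Module ℂ V] [AddCommGroup U] [Module ℂ U] [AddCommGroup X] [Module ℂ X]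
    (ρ : Representation ℂ ↥(unitaryGroupOfForm (UnitaryGroup.conjLocal L (IsCMField.complexConj L) v) (UnitaryGroup.cmLocalForm L 3 v)) V)
    (σ : Representation ℂ ↥(unitaryGroupOfForm (UnitaryGroup.conjLocal L (IsCMField.complexConj L) v) (UnitaryGroup.cmLocalForm L 3 v)) X)
    (R : V →ₗ[ℂ] X)
    (hR : ∀ (g : ↥(unitaryGroupOfForm (UnitaryGroup.conjLocal L (IsCMField.complexConj L) v) (UnitaryGroup.cmLocalForm L 3 v))) (w : V),
      R (ρ g w) = σ g (R w))
    (A : V →ₗ[ℂ] U) (hker : LinearMap.ker A ≤ LinearMap.ker R) (TwA : Wτ →ₗ[ℂ] Ut →ₗ[ℂ] U) (RtA : Vt →ₗ[ℂ] Ut) :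
    haveI := UnitaryGroup.locallyCompactSpace_cmBorelU L 3 v
    ∀ (T : Representation.SmoothInd (UnitaryGroup.cmBorelTriple L 3 v).P
        (Representation.twist (((Representation.trivial ℂ ↥(UnitaryGroup.torusU (UnitaryGroup.conjLocal L (IsCMField.complexConj L) v)
          (UnitaryGroup.cmLocalForm L 3 v)) ℂ).twist (UnitaryGroup.cmXiTorusChar L v μ η₁ η₂)).comp (UnitaryGroup.cmBorelTriple L 3 v).proj)
          (rootDeltaChar (UnitaryGroup.cmBorelTriple L 3 v).P)) →ₗ[ℂ] Vt →ₗ[ℂ] V),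
      (∀ (g : ↥(unitaryGroupOfForm (UnitaryGroup.conjLocal L (IsCMField.complexConj L) v) (UnitaryGroup.cmLocalForm L 3 v))) xv (φt : Vt),
          T (UnitaryGroup.cmPrincipalSeries L 3 v (UnitaryGroup.cmXiTorusChar L v μ η₁ η₂) g xv) φt = ρ g (T xv φt)) →
      (∀ xv (φt : Vt), A (T xv φt) = TwA (f xv) (RtA φt)) →
      f.ker.quotientRep.IsIrreducible ∧
      ∃ Φ : Vt → (UnitaryGroup.cmPrincipalSeries L 3 v (UnitaryGroup.cmXiTorusChar L v μ η₁ η₂)).IntertwiningMap σ,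
        (∀ (φt : Vt) xv, Φ φt xv = R (T xv φt)) ∧ (∀ φt : Vt, f.ker ≤ (Φ φt).ker) := by
  intro T hT hA
  obtain ⟨J, hJ⟩ := exists_factor_of_ker_le A R hker
  exact dictionary_D2_of_localIntertwiner h hns hμ hμc h1c h2c μZ hK hs hn f hσ hf0 ρ σ (TwA.compr₂ J) R RtA hR T hT
    (residue_dict_fac_of_factor_of_tensorClause T R A J f.toLinearMap TwA RtA hJ hA)

end Consumer

end Summit.HodgeConjecture.HodgeConjecture.R90.S8

end
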